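import Summits.BirchSwinnertonDyer.BirchSwinnertonDyer.Theses.SylvesterTwoHeegnerIndex
import Summits.BirchSwinnertonDyer.BirchSwinnertonDyer.Theorems.SylvesterTwoHeegnerIndexFirstLayerSplit
import Summits.BirchSwinnertonDyer.BirchSwinnertonDyer.Theorems.SylvesterTwoHeegnerIndexCoupledUpperBoundReductionSeven
import Summits.BirchSwinnertonDyer.BirchSwinnertonDyer.Theorems.SylvesterTwoHeegnerIndexCoupledDescentFirstLayerOfLayerL1

/-! # Skeleton VARIANT M for crux `UpperOffV0HSYPlus` (stmt-BirchSwinnertonDyer-19804) —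
«LAYER-(L1) / TAIL SPLIT of the coupled bounds, by residue class» (planner bsd-cm-plan g27, 2026-08-28, D441/D442;
supersedes the DEFECTIVE VARIANT L c745230b5cc31032 — `Lines/coupled_variantL-dead.md` — whose leaf stubs asked
(L1) at EVERY member with no m(p) = 0 antecedent and were refutable, k7t-c2 g22 finding STATUS l.2181 /
#21a/#21b; VARIANT K `Lines/coupled_variantK.lean` 9a39a679fe96c65a stays in the folder as the coarser reading).

SHAPE.  VARIANT K's two FIRST-LAYER stubs are CLOSED BY NAME inside this file from two NEW stubs through k7t-c2
g22 #22 `SylvesterTwoHeegnerIndexCoupledDescentFirstLayerOfLayerL1` (`firstLayerFour_of_layerL1`,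
`firstLayerSeven_of_layerL1`): `stub_layerL1Four : L1Four′` = leaf (L1) of p620148
(`SylvesterTwoHeegnerIndexCoupledDescentKolyvagin`) for every non-2-divisible bottom point Y₀ ∈ E_p(K) UNDER
`stub_firstLayerFour`'s OWN HYPOTHESES (PublishedFactsTwoPlus, the member p ≡ 4 (9) with 3 ∉ 𝔽_p³, minimal models
A, B, qB·qA = #Ш_an(B)·#Ш_an(A) ≠ 0 with ord₂ = 0 — the m(p) = 0 slice, where (L1) IS THEOREM K2's input; K any
quadratic number field ∋ ω; levels := conductors; Kol := the (L3) files' eight clauses), and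
`stub_layerL1Seven : HSYPointTwoDivisibleSevenModNine → L1Seven′` (THEOREM C (★) as ANTECEDENT: on the 7 (9)
slice (L1)'s local condition for B at w ∣ 3 is Kummer-at-3 only under (★), memo two §67 / k-ty1 g6 #12
p648302). By p647458 `hL1_of_hL1` each family is (L1) for ONE point (the rows' CM bottom point P₁^{χ_B}) +
«ord₂(qB·qA) = 0 ⇒ P₁^{χ_B} ∉ 2E_p(K)» (height display naming its point + Thm B′ — load-bearing). `stub_tailFour`,
`stub_tailSeven`, `stub_thmC` and the composition `UpperOffV0HSYPlus_of` are VARIANT K's VERBATIM.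
DEGENERATE-MEMBER / VACUITY PASS (planner D441, before registration): at a member with #Ш(E_p)[2^∞] ≠ 1 the
binder `padicValRat 2 (qB * qA) = 0` is not dischargeable (no kernel theorem gives BSD₂ for the pair), so #21a's
refutation of VARIANT L does not bite; Y₀ ranges over a nonempty type; (L1)'s ∃ (cA cB) carries two genuine iffs
at λ (no junk witness); ∀ K ranges over models of ℚ(ω) only.  Registered stubs (FIVE): `stub_layerL1Four`,
`stub_layerL1Seven` (row k-p1), `stub_tailFour`, `stub_tailSeven` (row k-p2), `stub_thmC` (item 19802).
Director-bsd g12 gating of record HOME/INBOX.md l.212 unchanged. Nothing is asserted; no stub is closed by this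
file; BSD is not claimed. -/

set_option linter.dupNamespace false

open scoped Classical
open WeierstrassCurve Literature.NumberTheory.EllipticCurves

namespace Summit.BirchSwinnertonDyer.BirchSwinnertonDyer.Cruxes.UpperOffV0HSYPlus.CoupledVariantM

open Summit.BirchSwinnertonDyer.BirchSwinnertonDyer.Theses.SylvesterTwoHeegnerIndex
open Summit.BirchSwinnertonDyer.BirchSwinnertonDyer.Theorems
open Summit.BirchSwinnertonDyer.BirchSwinnertonDyer.Theorems.SylvesterTwoCoupledUpperBound
open Summit.BirchSwinnertonDyer.BirchSwinnertonDyer.Theorems.SylvesterTwoFirstLayerSplit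
open Summit.BirchSwinnertonDyer.BirchSwinnertonDyer.Theorems.SylvesterTwoCoupledDescentCebotarev
open NumberField IsDedekindDomain Literature.NumberTheory.EllipticCurves.HuShuYin2019

/-- **stub (row k-p1, p ≡ 4 (9)) — L1Four′ = LEAF (L1) for every non-2-divisible bottom point UNDER THE FIRST
LAYER'S OWN HYPOTHESES** (k7t-c2 g22 #22's hypothesis type VERBATIM; VARIANT K's `stub_firstLayerFour` follows by
`firstLayerFour_of_layerL1`) [size L; research piece = the two AT-LEVEL FLIP iffs at λ for the CM bottom point +
«ord₂(qB·qA) = 0 ⇒ P₁^{χ_B} ∉ 2E_p(K)»]. -/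
theorem stub_layerL1Four : PublishedFactsTwoPlus →
      ∀ (p : ℕ), p.Prime → p % 9 = 4 → (¬ ∃ x : ZMod p, x ^ 3 = 3) →
        ∀ (A B : WeierstrassCurve ℚ) [A.IsElliptic] [A.IsGloballyMinimal] [B.IsElliptic]
          [B.IsGloballyMinimal], (∃ C : VariableChange ℚ, C • B = HuShuYin2019.cubeSumCurve (p : ℚ)) →
          (∃ C : VariableChange ℚ, C • A = HuShuYin2019.cubeSumCurve (3 * (p : ℚ) ^ 2)) →
          ∀ (qB qA : ℚ), shaAn B = (qB : ℂ) → shaAn A = (qA : ℂ) → qB * qA ≠ 0 →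
            padicValRat 2 (qB * qA) = 0 →
            ∀ (K : Type) [Field K] [NumberField K] (ω : K), ω ^ 2 + ω + 1 = 0 →
              Module.finrank ℚ K = 2 →
            ∀ Y₀ : ((cubeSumCurve (p : ℚ)).baseChange K).toAffine.Point,
              (¬ ∃ Q : ((cubeSumCurve (p : ℚ)).baseChange K).toAffine.Point, (2 : ℕ) • Q = Y₀) →
            ∃ (cA : ℕ → galH1Torsion ((cubeSumCurve (3 * (p : ℚ) ^ 2)).baseChange K) (2 : ℕ))
              (cB : ℕ → galH1Torsion ((cubeSumCurve (p : ℚ)).baseChange K) (2 : ℕ)),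
            (∀ ℓ, (ℓ.Prime ∧ ¬ ℓ ∣ (cubeSumCurve (3 * (p : ℚ) ^ 2)).conductorNorm ℤ ∧
                ¬ ℓ ∣ (cubeSumCurve (p : ℚ)).conductorNorm ℤ ∧ ¬ ((ℓ : ℤ) ∣ NumberField.discr K) ∧ ℓ ≠ 2 ∧
                (Ideal.span {(ℓ : 𝓞 K)}).IsPrime ∧
                FrobEqFrobInfty (cubeSumCurve (3 * (p : ℚ) ^ 2)) K 2 ℓ ∧
                FrobEqFrobInfty (cubeSumCurve (p : ℚ)) K 2 ℓ) →
              (∀ v : HeightOneSpectrum (𝓞 K), (ℓ : 𝓞 K) ∉ v.asIdeal →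
                cA ℓ ∈ selmerLocalKer ((cubeSumCurve (3 * (p : ℚ) ^ 2)).baseChange K)
                  (v.adicCompletion K) (2 : ℕ)) ∧
              (∀ x : InfinitePlace K, cA ℓ ∈ selmerLocalKer
                ((cubeSumCurve (3 * (p : ℚ) ^ 2)).baseChange K) x.Completion (2 : ℕ)) ∧
              (∀ v : HeightOneSpectrum (𝓞 K), (ℓ : 𝓞 K) ∈ v.asIdeal →
                (cA ℓ ∈ selmerLocalKer ((cubeSumCurve (3 * (p : ℚ) ^ 2)).baseChange K)
                    (v.adicCompletion K) (2 : ℕ) ↔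
                  kummerClassOfPoint (cubeSumCurve (p : ℚ)) K Nat.prime_two Y₀ ∈
                    ((cubeSumCurve (p : ℚ)).baseChange K).torsionLocalKer (v.adicCompletion K) (2 : ℕ)))) ∧
            (∀ ℓ ℓ', (ℓ.Prime ∧ ¬ ℓ ∣ (cubeSumCurve (3 * (p : ℚ) ^ 2)).conductorNorm ℤ ∧
                ¬ ℓ ∣ (cubeSumCurve (p : ℚ)).conductorNorm ℤ ∧ ¬ ((ℓ : ℤ) ∣ NumberField.discr K) ∧ ℓ ≠ 2 ∧
                (Ideal.span {(ℓ : 𝓞 K)}).IsPrime ∧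
                FrobEqFrobInfty (cubeSumCurve (3 * (p : ℚ) ^ 2)) K 2 ℓ ∧
                FrobEqFrobInfty (cubeSumCurve (p : ℚ)) K 2 ℓ) →
              (ℓ'.Prime ∧ ¬ ℓ' ∣ (cubeSumCurve (3 * (p : ℚ) ^ 2)).conductorNorm ℤ ∧
                ¬ ℓ' ∣ (cubeSumCurve (p : ℚ)).conductorNorm ℤ ∧ ¬ ((ℓ' : ℤ) ∣ NumberField.discr K) ∧
                ℓ' ≠ 2 ∧ (Ideal.span {(ℓ' : 𝓞 K)}).IsPrime ∧
                FrobEqFrobInfty (cubeSumCurve (3 * (p : ℚ) ^ 2)) K 2 ℓ' ∧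
                FrobEqFrobInfty (cubeSumCurve (p : ℚ)) K 2 ℓ') → ℓ ≠ ℓ' →
              (∀ v : HeightOneSpectrum (𝓞 K), (ℓ : 𝓞 K) ∉ v.asIdeal → (ℓ' : 𝓞 K) ∉ v.asIdeal →
                cB (ℓ * ℓ') ∈ selmerLocalKer ((cubeSumCurve (p : ℚ)).baseChange K)
                  (v.adicCompletion K) (2 : ℕ)) ∧
              (∀ x : InfinitePlace K,
                cB (ℓ * ℓ') ∈ selmerLocalKer ((cubeSumCurve (p : ℚ)).baseChange K) x.Completion (2 : ℕ)) ∧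
              (∀ v : HeightOneSpectrum (𝓞 K), (ℓ : 𝓞 K) ∈ v.asIdeal →
                (cB (ℓ * ℓ') ∈ selmerLocalKer ((cubeSumCurve (p : ℚ)).baseChange K)
                    (v.adicCompletion K) (2 : ℕ) ↔
                  cA ℓ' ∈ ((cubeSumCurve (3 * (p : ℚ) ^ 2)).baseChange K).torsionLocalKer
                    (v.adicCompletion K) (2 : ℕ)))) := by
  sorry

/-- **stub (row k-p1, p ≡ 7 (9)) — (★) → L1Seven′**: granted THEOREM C (item 19802, = `stub_thmC hF`), leaf (L1)
for every non-2-divisible bottom point under `stub_firstLayerSeven`'s own hypotheses (k7t-c2 g22 #22's hypothesis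
type VERBATIM behind the (★) antecedent; VARIANT K's `stub_firstLayerSeven` follows by `firstLayerSeven_of_layerL1`)
[size L]. -/
theorem stub_layerL1Seven : SylvesterTwoNonneg.HSYPointTwoDivisibleSevenModNine →
    (PublishedFactsTwoPlus →
      ∀ (p : ℕ), p.Prime → p % 9 = 7 → (¬ ∃ x : ZMod p, x ^ 3 = 3) →
        ∀ (A B : WeierstrassCurve ℚ) [A.IsElliptic] [A.IsGloballyMinimal] [B.IsElliptic]
          [B.IsGloballyMinimal], (∃ C : VariableChange ℚ, C • B = HuShuYin2019.cubeSumCurve (p : ℚ)) →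
          (∃ C : VariableChange ℚ, C • A = HuShuYin2019.cubeSumCurve (3 * (p : ℚ) ^ 2)) →
          ∀ (qB qA : ℚ), shaAn B = (qB : ℂ) → shaAn A = (qA : ℂ) → qB * qA ≠ 0 →
            padicValRat 2 (qB * qA) = 0 →
            ∀ (K : Type) [Field K] [NumberField K] (ω : K), ω ^ 2 + ω + 1 = 0 →
              Module.finrank ℚ K = 2 →
            ∀ Y₀ : ((cubeSumCurve (p : ℚ)).baseChange K).toAffine.Point,
              (¬ ∃ Q : ((cubeSumCurve (p : ℚ)).baseChange K).toAffine.Point, (2 : ℕ) • Q = Y₀) →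
            ∃ (cA : ℕ → galH1Torsion ((cubeSumCurve (3 * (p : ℚ) ^ 2)).baseChange K) (2 : ℕ))
              (cB : ℕ → galH1Torsion ((cubeSumCurve (p : ℚ)).baseChange K) (2 : ℕ)),
            (∀ ℓ, (ℓ.Prime ∧ ¬ ℓ ∣ (cubeSumCurve (3 * (p : ℚ) ^ 2)).conductorNorm ℤ ∧
                ¬ ℓ ∣ (cubeSumCurve (p : ℚ)).conductorNorm ℤ ∧ ¬ ((ℓ : ℤ) ∣ NumberField.discr K) ∧ ℓ ≠ 2 ∧
                (Ideal.span {(ℓ : 𝓞 K)}).IsPrime ∧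
                FrobEqFrobInfty (cubeSumCurve (3 * (p : ℚ) ^ 2)) K 2 ℓ ∧
                FrobEqFrobInfty (cubeSumCurve (p : ℚ)) K 2 ℓ) →
              (∀ v : HeightOneSpectrum (𝓞 K), (ℓ : 𝓞 K) ∉ v.asIdeal →
                cA ℓ ∈ selmerLocalKer ((cubeSumCurve (3 * (p : ℚ) ^ 2)).baseChange K)
                  (v.adicCompletion K) (2 : ℕ)) ∧
              (∀ x : InfinitePlace K, cA ℓ ∈ selmerLocalKer
                ((cubeSumCurve (3 * (p : ℚ) ^ 2)).baseChange K) x.Completion (2 : ℕ)) ∧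
              (∀ v : HeightOneSpectrum (𝓞 K), (ℓ : 𝓞 K) ∈ v.asIdeal →
                (cA ℓ ∈ selmerLocalKer ((cubeSumCurve (3 * (p : ℚ) ^ 2)).baseChange K)
                    (v.adicCompletion K) (2 : ℕ) ↔
                  kummerClassOfPoint (cubeSumCurve (p : ℚ)) K Nat.prime_two Y₀ ∈
                    ((cubeSumCurve (p : ℚ)).baseChange K).torsionLocalKer (v.adicCompletion K) (2 : ℕ)))) ∧
            (∀ ℓ ℓ', (ℓ.Prime ∧ ¬ ℓ ∣ (cubeSumCurve (3 * (p : ℚ) ^ 2)).conductorNorm ℤ ∧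
                ¬ ℓ ∣ (cubeSumCurve (p : ℚ)).conductorNorm ℤ ∧ ¬ ((ℓ : ℤ) ∣ NumberField.discr K) ∧ ℓ ≠ 2 ∧
                (Ideal.span {(ℓ : 𝓞 K)}).IsPrime ∧
                FrobEqFrobInfty (cubeSumCurve (3 * (p : ℚ) ^ 2)) K 2 ℓ ∧
                FrobEqFrobInfty (cubeSumCurve (p : ℚ)) K 2 ℓ) →
              (ℓ'.Prime ∧ ¬ ℓ' ∣ (cubeSumCurve (3 * (p : ℚ) ^ 2)).conductorNorm ℤ ∧
                ¬ ℓ' ∣ (cubeSumCurve (p : ℚ)).conductorNorm ℤ ∧ ¬ ((ℓ' : ℤ) ∣ NumberField.discr K) ∧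
                ℓ' ≠ 2 ∧ (Ideal.span {(ℓ' : 𝓞 K)}).IsPrime ∧
                FrobEqFrobInfty (cubeSumCurve (3 * (p : ℚ) ^ 2)) K 2 ℓ' ∧
                FrobEqFrobInfty (cubeSumCurve (p : ℚ)) K 2 ℓ') → ℓ ≠ ℓ' →
              (∀ v : HeightOneSpectrum (𝓞 K), (ℓ : 𝓞 K) ∉ v.asIdeal → (ℓ' : 𝓞 K) ∉ v.asIdeal →
                cB (ℓ * ℓ') ∈ selmerLocalKer ((cubeSumCurve (p : ℚ)).baseChange K)
                  (v.adicCompletion K) (2 : ℕ)) ∧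
              (∀ x : InfinitePlace K,
                cB (ℓ * ℓ') ∈ selmerLocalKer ((cubeSumCurve (p : ℚ)).baseChange K) x.Completion (2 : ℕ)) ∧
              (∀ v : HeightOneSpectrum (𝓞 K), (ℓ : 𝓞 K) ∈ v.asIdeal →
                (cB (ℓ * ℓ') ∈ selmerLocalKer ((cubeSumCurve (p : ℚ)).baseChange K)
                    (v.adicCompletion K) (2 : ℕ) ↔
                  cA ℓ' ∈ ((cubeSumCurve (3 * (p : ℚ) ^ 2)).baseChange K).torsionLocalKer
                    (v.adicCompletion K) (2 : ℕ))))) := by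
  sorry

/-- **CLOSED from `stub_layerL1Four` (g22 #22 `firstLayerFour_of_layerL1`) — FIRST LAYER, p ≡ 4 (9) = THEOREM K2 typed**: granted the route's facts, for the HSY
pair (B, A) = (E_p, E_{3p²}), `ord₂(#Ш_an(B)·#Ш_an(A)) = 0 ⇒ #Ш(B)[2^∞] = #Ш(A)[2^∞] = 1`
(Kolyvagin at level `M = 1` for the coupled pair; memo two §57; refereed g59/g60). [size L] -/
theorem firstLayerFour_closed : PublishedFactsTwoPlus →
    ∀ (p : ℕ), p.Prime → p % 9 = 4 → (¬ ∃ x : ZMod p, x ^ 3 = 3) →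
      ∀ (A B : WeierstrassCurve ℚ) [A.IsElliptic] [A.IsGloballyMinimal] [B.IsElliptic]
        [B.IsGloballyMinimal], (∃ C : VariableChange ℚ, C • B = HuShuYin2019.cubeSumCurve (p : ℚ)) →
        (∃ C : VariableChange ℚ, C • A = HuShuYin2019.cubeSumCurve (3 * (p : ℚ) ^ 2)) →
        ∀ (qB qA : ℚ), shaAn B = (qB : ℂ) → shaAn A = (qA : ℂ) → qB * qA ≠ 0 →
          padicValRat 2 (qB * qA) = 0 →
          Nat.card (AddCommGroup.primaryComponent B.sha 2) = 1 ∧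
            Nat.card (AddCommGroup.primaryComponent A.sha 2) = 1 :=
  firstLayerFour_of_layerL1 stub_layerL1Four

/-- **stub (row k-p2, p ≡ 4 (9)) — TAIL**: the coupled bound `s_B + s_A ≤ ord₂(#Ш_an(B)·#Ш_an(A))` on the
pairs with `4 < #Ш(B)[2^∞]·#Ш(A)[2^∞]` (induction over levels `2^M`, deep Kolyvagin primes; memo two
§64/§65, refereed g61). [size L–XL] -/
theorem stub_tailFour : PublishedFactsTwoPlus →
    ∀ (p : ℕ), p.Prime → p % 9 = 4 → (¬ ∃ x : ZMod p, x ^ 3 = 3) →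
      ∀ (A B : WeierstrassCurve ℚ) [A.IsElliptic] [A.IsGloballyMinimal] [B.IsElliptic]
        [B.IsGloballyMinimal], (∃ C : VariableChange ℚ, C • B = HuShuYin2019.cubeSumCurve (p : ℚ)) →
        (∃ C : VariableChange ℚ, C • A = HuShuYin2019.cubeSumCurve (3 * (p : ℚ) ^ 2)) →
        4 < Nat.card (AddCommGroup.primaryComponent B.sha 2) *
            Nat.card (AddCommGroup.primaryComponent A.sha 2) →
        ∃ qB qA : ℚ, shaAn B = (qB : ℂ) ∧ shaAn A = (qA : ℂ) ∧ qB * qA ≠ 0 ∧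
          (padicValNat 2 (Nat.card (AddCommGroup.primaryComponent B.sha 2)) : ℤ) +
              (padicValNat 2 (Nat.card (AddCommGroup.primaryComponent A.sha 2)) : ℤ) ≤
            padicValRat 2 (qB * qA) := by
  sorry

/-- **stub (item 19802) — THEOREM C typed**: `PublishedFactsTwoPlus → HSYPointTwoDivisibleSevenModNine`
(crux 19802's own skeleton ea25de9eb9afcd52; desk (M-K3-7) bears on its paper form). [size L] -/
theorem stub_thmC : PublishedFactsTwoPlus → SylvesterTwoNonneg.HSYPointTwoDivisibleSevenModNine := by
  sorry

/-- **CLOSED from `stub_thmC` + `stub_layerL1Seven` (g22 #22 `firstLayerSeven_of_layerL1`) — FIRST LAYER, p ≡ 7 (9) = COROLLARY K2(7) typed** (memo two §67: under THEOREM C's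
(★) the Kolyvagin classes are Kummer at 3 and the `M = 1` argument runs verbatim). [size L] -/
theorem firstLayerSeven_closed : PublishedFactsTwoPlus →
    ∀ (p : ℕ), p.Prime → p % 9 = 7 → (¬ ∃ x : ZMod p, x ^ 3 = 3) →
      ∀ (A B : WeierstrassCurve ℚ) [A.IsElliptic] [A.IsGloballyMinimal] [B.IsElliptic]
        [B.IsGloballyMinimal], (∃ C : VariableChange ℚ, C • B = HuShuYin2019.cubeSumCurve (p : ℚ)) →
        (∃ C : VariableChange ℚ, C • A = HuShuYin2019.cubeSumCurve (3 * (p : ℚ) ^ 2)) →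
        ∀ (qB qA : ℚ), shaAn B = (qB : ℂ) → shaAn A = (qA : ℂ) → qB * qA ≠ 0 →
          padicValRat 2 (qB * qA) = 0 →
          Nat.card (AddCommGroup.primaryComponent B.sha 2) = 1 ∧
            Nat.card (AddCommGroup.primaryComponent A.sha 2) = 1 :=
  fun hF ↦ firstLayerSeven_of_layerL1 (stub_layerL1Seven (stub_thmC hF)) hF

/-- **stub (row k-p2, p ≡ 7 (9)) — TAIL** (THEOREM K3*'s induction on the pairs with
`4 < #Ш(B)[2^∞]·#Ш(A)[2^∞]`; memo two §67–§68, desk (M-K3-7)). [size L–XL] -/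
theorem stub_tailSeven : PublishedFactsTwoPlus →
    ∀ (p : ℕ), p.Prime → p % 9 = 7 → (¬ ∃ x : ZMod p, x ^ 3 = 3) →
      ∀ (A B : WeierstrassCurve ℚ) [A.IsElliptic] [A.IsGloballyMinimal] [B.IsElliptic]
        [B.IsGloballyMinimal], (∃ C : VariableChange ℚ, C • B = HuShuYin2019.cubeSumCurve (p : ℚ)) →
        (∃ C : VariableChange ℚ, C • A = HuShuYin2019.cubeSumCurve (3 * (p : ℚ) ^ 2)) →
        4 < Nat.card (AddCommGroup.primaryComponent B.sha 2) *
            Nat.card (AddCommGroup.primaryComponent A.sha 2) →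
        ∃ qB qA : ℚ, shaAn B = (qB : ℂ) ∧ shaAn A = (qA : ℂ) ∧ qB * qA ≠ 0 ∧
          (padicValNat 2 (Nat.card (AddCommGroup.primaryComponent B.sha 2)) : ℤ) +
              (padicValNat 2 (Nat.card (AddCommGroup.primaryComponent A.sha 2)) : ℤ) ≤
            padicValRat 2 (qB * qA) := by
  sorry

/-- **Composition (kernel-checked)**: the crux BY NAME from the five stubs, through p590593's
`coupledUpperBoundFour_of_firstLayer_of_tail` / `coupledUpperBoundSeven_of_thmC_of_firstLayer_of_tail` and
K3R-7's splice `upperOffV0HSYPlus_of_coupledUpperBounds`. -/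
theorem UpperOffV0HSYPlus_of :
    Summit.BirchSwinnertonDyer.BirchSwinnertonDyer.Theses.SylvesterTwoHeegnerIndex.UpperOffV0HSYPlus :=
  fun hF =>
    upperOffV0HSYPlus_of_coupledUpperBounds
      (coupledUpperBoundFour_of_firstLayer_of_tail hF (firstLayerFour_closed hF) (stub_tailFour hF))
      (coupledUpperBoundSeven_of_thmC_of_firstLayer_of_tail hF (firstLayerSeven_closed hF) (stub_tailSeven hF)
        (stub_thmC hF)) hF

end Summit.BirchSwinnertonDyer.BirchSwinnertonDyer.Cruxes.UpperOffV0HSYPlus.CoupledVariantM
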